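import Mathlib
import Summits.Ventures.PercRepro2.TypedPocketA1BCertA

/-!
# The `{a₁, b}`-pocket class (HARRIS-1), II′: the Harris certificates, B (blind cell PercRepro2,
p3 g8, 2026-08-26; `proofs/P3-HARRIS.md` §3)

Slices 6–11 of the remainder check of `TypedPocketA1BCertA.lean`, and the assembly:
**`remH_nonneg`** — on every valid pair of triples the doubly symmetrised kernel dominates the
certified combination of slacks (`dsymH ≥ combH`), by sorting both sides (`dsymH_sort3O/B`,
`combH` is symmetric in the o-states and depends on the far triple only through its sorted
representative) and the 20 decided slices.  Own work; standard axioms.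
-/

namespace Summit.Ventures.PercRepro2

namespace CovForm

namespace PocketA1B

open OneTyped SepThree

/-! ## The slices 6–11 -/
/-- Slice 6: three sorted o-triples. -/
theorem allOkAt_6 :
    (allOkAt (false, false, true) (false, false, true) (true, true, true) &&
      allOkAt (false, false, true) (false, true, false) (false, true, false) &&
      allOkAt (false, false, true) (false, true, false) (true, false, false)) = true := by
  decide +kernel

/-- Slice 7: three sorted o-triples. -/
theorem allOkAt_7 :
    (allOkAt (false, false, true) (false, true, false) (true, true, true) &&
      allOkAt (false, false, true) (true, false, false) (true, false, false) &&
      allOkAt (false, false, true) (true, false, false) (true, true, true)) = true := by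
  decide +kernel

/-- Slice 8: three sorted o-triples. -/
theorem allOkAt_8 :
    (allOkAt (false, false, true) (true, true, true) (true, true, true) &&
      allOkAt (false, true, false) (false, true, false) (false, true, false) &&
      allOkAt (false, true, false) (false, true, false) (true, false, false)) = true := by
  decide +kernel

/-- Slice 9: three sorted o-triples. -/
theorem allOkAt_9 :
    (allOkAt (false, true, false) (false, true, false) (true, true, true) &&
      allOkAt (false, true, false) (true, false, false) (true, false, false) &&
      allOkAt (false, true, false) (true, false, false) (true, true, true)) = true := by
  decide +kernel

/-- Slice 10: three sorted o-triples. -/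
theorem allOkAt_10 :
    (allOkAt (false, true, false) (true, true, true) (true, true, true) &&
      allOkAt (true, false, false) (true, false, false) (true, false, false) &&
      allOkAt (true, false, false) (true, false, false) (true, true, true)) = true := by
  decide +kernel

/-- Slice 11: two sorted o-triples. -/
theorem allOkAt_11 :
    (allOkAt (true, false, false) (true, true, true) (true, true, true) &&
      allOkAt (true, true, true) (true, true, true) (true, true, true)) = true := by
  decide +kernel

/-! ## The assembly -/

/-- The nonnegativity on the sorted representatives as a Boolean computation (12 slices). -/
theorem remH_nonneg_all : (oTriples.all fun s => allOkAt s.1 s.2.1 s.2.2) = true := by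
  rw [oTriples_eq]
  simp only [List.all_cons, List.all_nil, Bool.and_true, Bool.and_eq_true]
  have h0 := and3 allOkAt_0
  have h1 := and3 allOkAt_1
  have h2 := and3 allOkAt_2
  have h3 := and3 allOkAt_3
  have h4 := and3 allOkAt_4
  have h5 := and3 allOkAt_5
  have h6 := and3 allOkAt_6
  have h7 := and3 allOkAt_7
  have h8 := and3 allOkAt_8
  have h9 := and3 allOkAt_9
  have h10 := and3 allOkAt_10
  have h11 := (Bool.and_eq_true _ _).mp allOkAt_11
  exact ⟨h0.1, h0.2.1, h0.2.2, h1.1, h1.2.1, h1.2.2, h2.1, h2.2.1, h2.2.2,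
    h3.1, h3.2.1, h3.2.2, h4.1, h4.2.1, h4.2.2, h5.1, h5.2.1, h5.2.2,
    h6.1, h6.2.1, h6.2.2, h7.1, h7.2.1, h7.2.2, h8.1, h8.2.1, h8.2.2,
    h9.1, h9.2.1, h9.2.2, h10.1, h10.2.1, h10.2.2, h11.1, h11.2⟩

/-- **The remainder is nonnegative on every sorted pair of valid triples.** -/
theorem remH_nonneg_sorted : ∀ s ∈ oTriples, ∀ t ∈ bTriples,
    0 ≤ remH s.1 s.2.1 s.2.2 t.1 t.2.1 t.2.2 := by
  rintro ⟨x, y, w⟩ hs ⟨u, v, r⟩ ht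
  rw [mem_oTriples] at hs
  rw [mem_bTriples] at ht
  have key := remH_nonneg_all
  simp only [List.all_eq_true] at key
  have h := key (x, y, w) (mem_oTriples.2 hs)
  simp only [allOkAt, bSorted, List.all_eq_true, decide_eq_true_eq, List.mem_filter] at h
  exact h u ht.1.1 v ⟨ht.1.2.1, ht.2.1⟩ r ⟨ht.1.2.2, ht.2.2⟩

/-- `combH` is symmetric in the first two o-states. -/
lemma combH_swapO12 (x y w : OSt) (u v r : BSt) : combH x y w u v r = combH y x w u v r := by
  unfold combH
  congr 1
  refine List.map_congr_left fun c _ => ?_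
  unfold genH
  ring

/-- `combH` is symmetric in the last two o-states. -/
lemma combH_swapO23 (x y w : OSt) (u v r : BSt) : combH x y w u v r = combH x w y u v r := by
  unfold combH
  congr 1
  refine List.map_congr_left fun c _ => ?_
  unfold genH
  ring

/-- `combH` is unchanged by sorting the o-states. -/
lemma combH_sort3O (x y w : OSt) (u v r : BSt) :
    combH x y w u v r = combH (sort3O x y w).1 (sort3O x y w).2.1 (sort3O x y w).2.2 u v r := by
  unfold sort3O
  split_ifs <;> dsimp only <;>
    first
    | rfl
    | exact combH_swapO12 x y w u v r
    | exact combH_swapO23 x y w u v r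
    | exact (combH_swapO12 x y w u v r).trans (combH_swapO23 y x w u v r)
    | exact (combH_swapO23 x y w u v r).trans (combH_swapO12 x w y u v r)
    | exact ((combH_swapO12 x y w u v r).trans (combH_swapO23 y x w u v r)).trans
        (combH_swapO12 y w x u v r)

/-- **THE KERNEL DOMINATES THE CERTIFIED COMBINATION on valid o-states and SORTED far states.** -/
theorem dsymH_ge_combH_sorted (x y w : OSt) (u v r : BSt) (hx : ValidO x = true)
    (hy : ValidO y = true) (hw : ValidO w = true) (ht : (u, v, r) ∈ bTriples) :
    combH x y w u v r ≤ dsymH x y w u v r := by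
  rw [dsymH_sort3O, combH_sort3O]
  have h := remH_nonneg_sorted _ (sort3O_mem x y w hx hy hw) _ ht
  unfold remH at h
  exact sub_nonneg.1 h

end PocketA1B

end CovForm

end Summit.Ventures.PercRepro2
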